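import Summits.BirchSwinnertonDyer.Rank1Residual.GaloisImage.KatoZetaValueDerivativeCongruenceOfZetaBody
import Summits.BirchSwinnertonDyer.Rank1Residual.GaloisImage.KatoKuriharaValueRowOfComparison
import Summits.BirchSwinnertonDyer.Rank1Residual.GaloisImage.KatoTwistAugmentationUnit
import Summits.BirchSwinnertonDyer.Rank1Residual.GaloisImage.CyclotomicNormalBasis
import Summits.BirchSwinnertonDyer.Rank1Residual.GaloisImage.KatoCharSumFourierInversion
import Literature.NumberTheory.EllipticCurves.PAdicLFunctionMinusIntegralityProofs
import Literature.NumberTheory.EllipticCurves.CuspFormLFunctionLevelConductorProofs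
import Literature.NumberTheory.EllipticCurves.PAdicLFunctionProofs
import HarnessLib

/-!
# The per-level VALUE ROWS of ★ PK-6₂ from `ZetaBody` — the discharger of `hvalue`
# (ROW T-PK6-VDIS; cell `b2b-bsdres`, team n1011, seat p02 GEN 15 — PK-6 lineage, value side)

HONEST FRAMING (cell `b2b-bsdres`, run/shared/lean/b2b/bsd-rank1-residual/, verbatim in every
file): the goal of the cell is to DELETE the COMBINATION-SHAPED residual classes of the
Birch–Swinnerton-Dyer formula for ALL analytic-rank `≤ 1` elliptic curves over `ℚ` — "full BSD
formula for every rank `≤ 1` curve in class `C`" assembled STRICTLY from published theorems — so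
that the rank-`≤ 1` remainder becomes exactly the CONSTRUCTION-SHAPED classes, which are TYPED
(missing-input `Prop`s), NOT attempted. This is not "finishing BSD". Team n1011 (N10/N11; ROUTE 1,
the PORT anatomy (P-KIM) of class X4 ∧ `p = 3`): research route on CONSTRUCTION-SHAPED classes;
prove what is provable now; no claim beyond stated classes; census output = EVIDENCE, never a
Literature fact; RESIDUAL-MAP marks UNCHANGED; nothing is booked by this file.  THIS IS AN
END-TYPE TOOL THEOREM WITH DISPLAYED HYPOTHESES: no definition, no named fact, no instance, no
`sorry`; Kato's fact `ZetaBody` enters as the displayed HYPOTHESIS `hbody` (never obtained).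

## What

★ PK-6₂ (`katoKuriharaPortThreeAtWith₂_zero_of_zetaBody`, n1011-p13) DISPLAYS, as binder (e)
`hvalue`, the per-level VALUE ROWS: for every depth `j`, every admissible Kolyvagin datum
`σ_q ∈ I_q`, `χ_{N𝔮}(σ_q) = η_q`, and every finite set `r` of usable primes that are Kolyvagin of
level `j + 1` with `η` primitive on `r`,
`∃ s u ψ, (∀ q ∈ r, ψ_{N𝔮} onto) ∧ hval(s) ∧ s̄ = u · p^t · kuriharaNumber f (p^{j+1}) (∏_{q∈r} N𝔮) ψ`.
★★ `valueRow_of_zetaBody` PROVES that row (any `t`) from: `hbody : ZetaBody W p f ι κ Λ c d a A z x`,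
`hf : IsNewformOf W f`, `p ≠ 2`, `E[p]` irreducible (`hirr`), the rationality of `κ` with `v_p(κ) = 0`
(`hNorm`, ROUTE-1 §53.5 R-κ (b)) and `κ ≠ 0`, END-m1's level-free guards `d′`, `gcd(cd, A) = 1`,
`dd′ ≡ 1 (mod A)`, two further level-free guards `gcd(A, N) = 1` (`p`-integrality of the four cusp
symbols `[a/A]⁻, [ac/A]⁻, [ad′/A]⁻, [acd′/A]⁻`, Mazur–Tate–Teitelbaum §I.8) and `p² ∣ N` (additive
reduction at `p`: `a_p(f) = 0`, Atkin–Lehner Thm. 3, so the `p`-Euler factor inside the twist is `1`),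
integer models `aM q` of `a_q(f)` for `q ∣ pA`, and END-m1's two certificates written on them:
`v_p(∏_{q∣pA}(1 − a_q/q + 𝟙_{q∤N}/q)) = 0` and `v_p(R⁻) = 0` (`R⁻` the four-term cusp factor).
EVERYTHING ELSE that n1011-p15's derivative congruence
`EulerFactorComparison.prod_deriv_mul_plusAvatar_sub_mem_map_span_of_zetaBody` (PK-4b-C4b-2 (v))
displays is DISCHARGED here: the embedding unit (`CharSum.exists_units_apply_zeta_eq_exp`), the avatar
`X` of `x_{0,r}` (T-PKEV E-D, `n(r)` square-free), the units `[q], [c], [d] mod n(r)`, the twist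
`Vq = (1 + δ₋₁)·uκ δ_{u⁻¹}·E·C⁻` (by `rfl`), `K = j + 1` (`IsKolyvaginPrime.modEq_one`), the integral
structure `Θ₀` of `θ̃_f(n(r))` (`exists_padicLift_modularElement` + Stevens integrality), and the
INTEGRAL LIFT `V ∈ ℤ_p[(ℤ/n)ˣ]` of `Vq` (FILE 2 `exists_padicLift_twist`: every scalar of `Vq` is
`p`-integral under the guards) whose augmentation is a unit by FILE 2
`isUnit_sum_coeff_twist_of_certificates`.  The derivative units are `b_q := χ_{n(r)}(σ_q)`, for
which (v)'s `hb` is T-PK6-VROW ★ `unitsMap_modNCyclotomicCharacter_eq_one_of_mem_inertia`; the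
composition is (v) ⟶ T-PK6-VROW ★★ `exists_valueRow_of_mem_map_span`.

HONEST LIMITS: closes nothing by itself (TOOL); books nothing; the rows are proved only under the
displayed guards (`p² ∣ N` = additive reduction at `p` — class X4 at `p = 3` with `N` the conductor).

References: K. Kato, Astérisque 295 (2004) Thm. 6.6 (1) p. 163, §6.2 p. 161, Thm. 9.7 p. 189
[Kato2004Asterisque]; C.-H. Kim, AJM 148 (2026) = arXiv:2203.12159, §1.4.1, §3.4–3.5 and the proof of
Thm. 3.13 [Kim2022StructureSelmer]; B. Mazur, J. Tate, J. Teitelbaum, Invent. Math. 84 (1986) §I.8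
[MazurTateTeitelbaum1986Invent]; A. O. L. Atkin, J. Lehner, Math. Ann. 185 (1970) Thm. 3
[AtkinLehner1970]; M. Kurihara, arXiv:1407.2465 §1.1 [Kurihara2014]; K. Rubin, *Euler Systems* (2000)
§4.4 [Rubin2000]; design `cells/n1011/ROUTE-1.md` §58 (r1), ★ PK-6₂ names line (p13 GEN 14, cell
INBOX 2026-08-22T11:59Z), C4b-2 (v) names line (p15 GEN 10, 11:35Z).
-/

noncomputable section

open scoped BigOperators NumberField TensorProduct
open Finset IsDedekindDomain NumberField Field WeierstrassCurve Rat.HeightOneSpectrum MonoidAlgebra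
open Literature.NumberTheory.GaloisRepresentations Literature.NumberTheory.GaloisCohomology
open Literature.NumberTheory.EllipticCurves Literature.NumberTheory.EllipticCurves.ModularForms
open Literature.NumberTheory.EllipticCurves.Kato2004
open Literature.NumberTheory.EllipticCurves.Kato2004.EulerSystemValues

namespace Summit.BirchSwinnertonDyer.Rank1Residual.GaloisImage.ValueRow

/-! ### ★★ The value rows from `ZetaBody` -/

section Main

variable {W : WeierstrassCurve ℚ} [W.IsElliptic] [W.IsGloballyMinimal] {p : ℕ} [Fact p.Prime]
  [ContinuousSMul ℤ_[p] (W.tateModule p)] [Module.Free ℤ_[p] (W.tateModule p)]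
  [Module.Finite ℤ_[p] (W.tateModule p)] {N : ℕ} [NeZero N] {f : CuspForm (CongruenceSubgroup.Gamma0 N) 2}
  {ι : (m : ℕ) → (CyclotomicField m ℚ →+* ℂ)} {κ : ℝ}
  {Λ : ∀ (k : ℕ) (r : Finset (HeightOneSpectrum (𝓞 ℚ))),
    H1 (tateRep W p) (cycSubgroup p k r) →ₗ[ℤ_[p]] ℚ_[p] ⊗[ℚ] CyclotomicField (cycLevel p k r) ℚ}
  {c d a : ℤ} {A : ℕ} [NeZero A]
  {z : ∀ (k : ℕ) (r : (cyclotomicLevelsRat p (badPlaces c d A N)).Ideals),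
    H1 (tateRep W p) ((cyclotomicLevelsRat p (badPlaces c d A N)).level k r.1)}
  {x : ∀ (k : ℕ) (r : (cyclotomicLevelsRat p (badPlaces c d A N)).Ideals),
    CyclotomicField (cycLevel p k r.1) ℚ}

set_option backward.isDefEq.respectTransparency false in
/-- **★★ THE VALUE ROW at `(j, σ, r)` FROM `ZetaBody`** — ★ PK-6₂'s displayed `hvalue`
(`katoKuriharaPortThreeAtWith₂_zero_of_zetaBody`, binder (e)) at one depth `j`, one admissible datum
`σ` (`σ_q ∈ I_q`, `χ_{N𝔮}(σ_q) = η_q`) and one finite set `r` of usable primes, Kolyvagin of level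
`j + 1`, with `η` primitive on `r`; any `t`.  Displayed: `hbody`, `hf`, `hp2`, `hirr`, `hNorm`/`hκ0`
(R-κ (b)), the guards `d′`, `hcd`, `hdd′`, `hAN`, `hpN`, the integer models `aM`/`haM` of `a_q(f)`,
`q ∣ pA`, and END-m1's certificates `hE0`/`hE`, `hR0`/`hR`; see the module docstring for what is
discharged inside and how.
[cite: Kim2022StructureSelmer, §1.4.1, §3.4.1–§3.5 and the proof of Thm. 3.13 (arXiv v3 pp. 7, 26–28; = Thm. 3.11 of AJM 148)]
[cite: Kato2004Asterisque, Thm. 6.6 (1) (p. 163), §6.2 (p. 161) and Thm. 9.7 (p. 189)]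
[cite: MazurTateTeitelbaum1986Invent, §I.8] [cite: AtkinLehner1970, Thm. 3] -/
theorem valueRow_of_zetaBody
    (hbody : ZetaBody W p f ι κ Λ c d a A z x) (hf : IsNewformOf W f) (hp2 : p ≠ 2)
    (hirr : W.HasIrreducibleModPGaloisRep p)
    (hNorm : ∃ u : ℚ, (u : ℝ) = κ ∧ padicValRat p u = 0) (hκ0 : κ ≠ 0)
    (d' : ℤ) (hcd : Int.gcd (c * d) A = 1) (hdd' : d * d' ≡ 1 [ZMOD (A : ℤ)])
    (hAN : Nat.Coprime A N) (hpN : p ^ 2 ∣ N)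
    (aM : ℕ → ℤ) (haM : ∀ q ∈ (p * A).primeFactors, cuspCoeff f q = aM q)
    (hE0 : ∏ q ∈ (p * A).primeFactors, (1 - (aM q : ℚ) / q + (if q ∣ N then 0 else (1 / q : ℚ))) ≠ 0)
    (hE : padicValRat p
      (∏ q ∈ (p * A).primeFactors, (1 - (aM q : ℚ) / q + (if q ∣ N then 0 else (1 / q : ℚ)))) = 0)
    (hR0 : (c : ℚ) ^ 2 * (d : ℚ) ^ 2 * ratMinusSymbol f ((a : ℚ) / A) -
        (c : ℚ) * (d : ℚ) ^ 2 * ratMinusSymbol f ((a * c : ℚ) / A) -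
        (c : ℚ) ^ 2 * (d : ℚ) * ratMinusSymbol f ((a * d' : ℚ) / A) +
        (c : ℚ) * (d : ℚ) * ratMinusSymbol f ((a * c * d' : ℚ) / A) ≠ 0)
    (hR : padicValRat p ((c : ℚ) ^ 2 * (d : ℚ) ^ 2 * ratMinusSymbol f ((a : ℚ) / A) -
        (c : ℚ) * (d : ℚ) ^ 2 * ratMinusSymbol f ((a * c : ℚ) / A) -
        (c : ℚ) ^ 2 * (d : ℚ) * ratMinusSymbol f ((a * d' : ℚ) / A) +
        (c : ℚ) * (d : ℚ) * ratMinusSymbol f ((a * c * d' : ℚ) / A)) = 0)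
    (η : (q : HeightOneSpectrum (𝓞 ℚ)) → (ZMod (Ideal.absNorm q.asIdeal))ˣ)
    (j t : ℕ) (σ : HeightOneSpectrum (𝓞 ℚ) → absoluteGaloisGroup ℚ)
    (hσI : ∀ q, σ q ∈ (adicCompletionPrime ℚ q).inertia (absoluteGaloisGroup ℚ))
    (hσχ : ∀ q, modNCyclotomicCharacter ℚ (Ideal.absNorm q.asIdeal) (σ q) = η q)
    (r : Finset (HeightOneSpectrum (𝓞 ℚ)))
    (hr : ∀ q ∈ r, q ∈ (cyclotomicLevelsRat p (badPlaces c d A N)).primes)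
    (hKol : ∀ q ∈ r, Kato.IsKolyvaginPrime W p (j + 1) ((primesEquiv q : Nat.Primes) : ℕ))
    (hη : ∀ q ∈ r, Subgroup.zpowers (η q) = ⊤) :
    ∃ (s : ℤ_[p]) (u : (ZMod (p ^ (j + 1)))ˣ)
      (ψ : (ℓ : ℕ) → (ZMod ℓ)ˣ →* Multiplicative (ZMod (p ^ (j + 1)))),
      (∀ q ∈ r, Function.Surjective (ψ (Ideal.absNorm q.asIdeal))) ∧
      (∃ l ∈ cycIntLattice p (cycLevel p 0 r),
        ((p : ℤ_[p]) ^ t) • ((1 : ℚ_[p]) ⊗ₜ[ℚ]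
          ((r.noncommProd (fun ℓ : HeightOneSpectrum (𝓞 ℚ) =>
              ∑ j ∈ Finset.range (((primesEquiv ℓ : Nat.Primes) : ℕ) - 1),
                (j : Module.End ℚ (CyclotomicField (cycLevel p 0 r) ℚ)) *
                  (sigma (cycLevel p 0 r) (modNCyclotomicCharacter ℚ (cycLevel p 0 r) (σ ℓ)) :
                    CyclotomicField (cycLevel p 0 r) ℚ →ₐ[ℚ]
                      CyclotomicField (cycLevel p 0 r) ℚ).toLinearMap ^ j)
            (ZetaValue.pairwise_commute_fieldDeriv (cycLevel p 0 r)
              (fun ℓ => modNCyclotomicCharacter ℚ (cycLevel p 0 r) (σ ℓ))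
              (fun ℓ => ((primesEquiv ℓ : Nat.Primes) : ℕ) - 1) r))
            (x 0 ⟨r, hr⟩ + sigma (cycLevel p 0 r) (-1) (x 0 ⟨r, hr⟩)))) -
          ((s : ℚ_[p]) ⊗ₜ[ℚ] (1 : CyclotomicField (cycLevel p 0 r) ℚ)) =
        ((p : ℤ_[p]) ^ (j + 1)) • (l : ℚ_[p] ⊗[ℚ] CyclotomicField (cycLevel p 0 r) ℚ)) ∧
      haveI : NeZero (∏ q ∈ r, Ideal.absNorm q.asIdeal) :=
        ⟨Finset.prod_ne_zero_iff.2 fun q _ h => q.ne_bot (Ideal.absNorm_eq_zero_iff.1 h)⟩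
      PadicInt.toZModPow (j + 1) s = (u : ZMod (p ^ (j + 1))) *
        ((p : ℕ) : ZMod (p ^ (j + 1))) ^ t *
          kuriharaNumber f (p ^ (j + 1)) (∏ q ∈ r, Ideal.absNorm q.asIdeal) ψ := by
  classical
  -- the level `n = n(r)` and its primes
  have hprim : ∀ q ∈ r, ¬ ((primesEquiv q : Nat.Primes) : ℕ) ∣ 2 * c.natAbs * d.natAbs * A * N ∧
      ((primesEquiv q : Nat.Primes) : ℕ) ≠ p := fun q hq =>
    (mem_primes_cyclotomicLevelsRat_badPlaces_iff p c d A N q).mp (hr q hq)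
  have hn : cycLevel p 0 r = ∏ q ∈ r, ((primesEquiv q : Nat.Primes) : ℕ) :=
    TameLevel.cycLevel_zero_eq_prod p r
  have hsq : Squarefree (cycLevel p 0 r) := TameLevel.squarefree_cycLevel_zero p r
  have hnN : (cycLevel p 0 r).Coprime N := by
    rw [hn]
    exact Nat.Coprime.prod_left fun q hq => (Nat.Prime.coprime_iff_not_dvd (primesEquiv q).2).mpr
      fun h => (hprim q hq).1 (dvd_mul_of_dvd_right h _)
  have hncd : (cycLevel p 0 r).Coprime (c.natAbs * d.natAbs) := by
    rw [hn]
    exact Nat.Coprime.prod_left fun q hq => (Nat.Prime.coprime_iff_not_dvd (primesEquiv q).2).mpr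
      fun h => (hprim q hq).1 (by
        obtain ⟨w, hw⟩ := h
        exact ⟨2 * A * N * w, by rw [show 2 * c.natAbs * d.natAbs * A * N =
          (c.natAbs * d.natAbs) * (2 * A * N) by ring, hw]; ring⟩)
  have hM : (p * A).Coprime (cycLevel p 0 r) := by
    rw [hn]
    refine Nat.Coprime.prod_right fun q hq => Nat.Coprime.mul_left ?_ ?_
    · exact (Nat.coprime_primes Fact.out (primesEquiv q).2).mpr (hprim q hq).2.symm
    · exact ((Nat.Prime.coprime_iff_not_dvd (primesEquiv q).2).mpr fun h =>
        (hprim q hq).1 (dvd_mul_of_dvd_left (dvd_mul_of_dvd_right h _) _)).symm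
  have hcdn : Int.gcd (c * d) (cycLevel p 0 r * A) = 1 := by
    rw [Int.gcd_eq_natAbs] at hcd ⊢
    rw [Int.natAbs_mul] at hcd ⊢
    have h2 : ((cycLevel p 0 r : ℤ) * (A : ℤ)).natAbs = cycLevel p 0 r * A := by
      rw [Int.natAbs_mul, Int.natAbs_natCast, Int.natAbs_natCast]
    rw [Int.natAbs_natCast] at hcd
    rw [h2]
    exact Nat.Coprime.mul_right hncd.symm hcd
  -- R-κ (b)
  obtain ⟨uκ, huκ, hvu⟩ := hNorm
  have huκ0 : uκ ≠ 0 := by rintro rfl; exact hκ0 (by rw [← huκ, Rat.cast_zero])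
  have huκ1 : ‖(uκ : ℚ_[p])‖ ≤ 1 := by
    rw [Padic.norm_eq_zpow_neg_valuation (by exact_mod_cast huκ0), Padic.valuation_ratCast, hvu,
      neg_zero, zpow_zero]
  -- the embedding unit, the avatar, the units mod `n`
  obtain ⟨u, hι⟩ := CharSum.exists_units_apply_zeta_eq_exp (cycLevel p 0 r) (ι (cycLevel p 0 r))
  obtain ⟨X, hxX, -⟩ :=
    GroupRingEval.exists_unique_eq_sum_coeff_smul_sigma_zeta (cycLevel p 0 r) hsq (x 0 ⟨r, hr⟩)
  have hcu : IsUnit ((c : ℤ) : ZMod (cycLevel p 0 r)) := by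
    rw [ZMod.coe_int_isUnit_iff_isCoprime, Int.isCoprime_iff_gcd_eq_one, Int.gcd_eq_natAbs,
      Int.natAbs_natCast]
    exact Nat.Coprime.coprime_dvd_right (dvd_mul_right _ _) hncd
  have hdu : IsUnit ((d : ℤ) : ZMod (cycLevel p 0 r)) := by
    rw [ZMod.coe_int_isUnit_iff_isCoprime, Int.isCoprime_iff_gcd_eq_one, Int.gcd_eq_natAbs,
      Int.natAbs_natCast]
    exact Nat.Coprime.coprime_dvd_right (dvd_mul_left _ _) hncd
  let uq : ℕ → (ZMod (cycLevel p 0 r))ˣ := fun q =>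
    if h : q.Coprime (cycLevel p 0 r) then ZMod.unitOfCoprime q h else 1
  have huq : ∀ q ∈ (p * A).primeFactors,
      ((uq q : (ZMod (cycLevel p 0 r))ˣ) : ZMod (cycLevel p 0 r)) = q := by
    intro q hq
    have h : q.Coprime (cycLevel p 0 r) := Nat.Coprime.coprime_dvd_left (Nat.dvd_of_mem_primeFactors hq) hM
    simp only [uq, dif_pos h, ZMod.coe_unitOfCoprime]
  -- Kolyvagin depth
  have hK : ∀ q ∈ r, p ^ (j + 1) ∣ ((primesEquiv q : Nat.Primes) : ℕ) - 1 := fun q hq =>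
    (Nat.modEq_iff_dvd' (primesEquiv q).2.one_lt.le).mp (hKol q hq).modEq_one.symm
  -- the integral structure `Θ₀` of `θ̃_f(n)` (Stevens integrality)
  obtain ⟨Θ₀, hΘ⟩ := exists_padicLift_modularElement f p (cycLevel p 0 r) fun b => by
    have h := hf.norm_ratPlusSymbol_div_le_one hp2 hirr hnN ((b : ZMod (cycLevel p 0 r)).val : ℤ)
    rwa [Int.cast_natCast] at h
  -- the integral lift `V` of the twist
  have hQ := hf.coeffField_eq_bot
  have hreal : ∀ m, (cuspCoeff f m).im = 0 := cuspCoeff_im_eq_zero_of_coeffField_eq_bot hQ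
  have hap : aM p = 0 := by
    have h := haM p (Nat.mem_primeFactors.mpr ⟨Fact.out, dvd_mul_right p A,
      mul_ne_zero (Fact.out : p.Prime).ne_zero (NeZero.ne A)⟩)
    rw [hf.1.cuspCoeff_eq_zero_of_sq_dvd Fact.out hpN] at h
    exact_mod_cast h.symm
  have hpN1 : p ∣ N := dvd_trans (dvd_pow_self p two_ne_zero) hpN
  have haq : ∀ q ∈ (p * A).primeFactors, ‖((((aM q : ℚ) / q : ℚ)) : ℚ_[p])‖ ≤ 1 := by
    intro q hq
    by_cases hqp : q = p
    · subst hqp; rw [hap, Int.cast_zero, zero_div, Rat.cast_zero, norm_zero]; exact zero_le_one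
    · exact norm_ratCast_div_le_one_of_ne p (Nat.prime_of_mem_primeFactors hq) hqp (aM q)
  have hNq : ∀ q ∈ (p * A).primeFactors,
      ‖(((if q ∣ N then 0 else (1 / q : ℚ)) : ℚ) : ℚ_[p])‖ ≤ 1 := by
    intro q hq
    by_cases hqN : q ∣ N
    · rw [if_pos hqN, Rat.cast_zero, norm_zero]; exact zero_le_one
    · rw [if_neg hqN]
      have hqp : q ≠ p := fun h => hqN (h ▸ hpN1)
      have h := norm_ratCast_div_le_one_of_ne p (Nat.prime_of_mem_primeFactors hq) hqp 1
      rwa [Int.cast_one] at h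
  have hsymb : ∀ m : ℤ, ‖((ratMinusSymbol f ((m : ℚ) / A) : ℚ) : ℚ_[p])‖ ≤ 1 := fun m =>
    norm_ratMinusSymbol_le_one f hp2 hreal (coprime_den_of_coprime hAN m)
  obtain ⟨V, hV⟩ := exists_padicLift_twist p f u uκ (p * A) N uq aM _ rfl c d a d' A hcu.unit hdu.unit
    _ rfl _ rfl huκ1 haq hNq (hsymb a)
    (by have h := hsymb (a * c); rwa [Int.cast_mul] at h)
    (by have h := hsymb (a * d'); rwa [Int.cast_mul] at h)
    (by have h := hsymb (a * c * d'); rwa [Int.cast_mul, Int.cast_mul] at h)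
  have hVu : IsUnit (∑ g : (ZMod (cycLevel p 0 r))ˣ, V.coeff g) :=
    isUnit_sum_coeff_twist_of_certificates p hp2 f u uκ (p * A) N uq aM _ rfl c d a d' A hcu.unit
      hdu.unit _ rfl _ rfl V hV huκ0 hvu hE0 hE hR0 hR
  -- PK-4b-C4b-2 (v): the derivative congruence at `b := χ_n ∘ σ`
  have hmem := EulerFactorComparison.prod_deriv_mul_plusAvatar_sub_mem_map_span_of_zetaBody
    hbody hf hp2 hirr ⟨r, hr⟩ d' hcdn hdd' uκ huκ u hι X hxX
    (fun q => modNCyclotomicCharacter ℚ (cycLevel p 0 r) (σ q))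
    (fun q _ ℓ' hℓ' hne => unitsMap_modNCyclotomicCharacter_eq_one_of_mem_inertia p σ hσI r q hℓ' hne)
    uq huq aM haM _ rfl hcu.unit hdu.unit hcu.unit_spec hdu.unit_spec _ rfl _ rfl (j + 1) hK Θ₀ hΘ V hV
  -- T-PK6-VROW ★★
  exact exists_valueRow_of_mem_map_span p f hp2 hf hirr j t σ η hσI hσχ r hη hKol (x 0 ⟨r, hr⟩) X hxX
    Θ₀ hΘ V hVu hmem

set_option backward.isDefEq.respectTransparency false in
/-- **★ PK-6₂'s binder (e) `hvalue`, DISCHARGED** — the value rows at every depth `j`, every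
admissible datum and every usable Kolyvagin level, in the literal binder order of
`katoKuriharaPortThreeAtWith₂_zero_of_zetaBody` (`t = 0`), from the displayed hypotheses of
`valueRow_of_zetaBody`. [cite: Kim2022StructureSelmer, the proof of Thm. 3.13 (arXiv v3 pp. 26–28; = Thm. 3.11 of AJM 148)]
[cite: Kato2004Asterisque, Thm. 6.6 (1) (p. 163) and Thm. 9.7 (p. 189)] -/
theorem valueRows_of_zetaBody
    (hbody : ZetaBody W p f ι κ Λ c d a A z x) (hf : IsNewformOf W f) (hp2 : p ≠ 2)
    (hirr : W.HasIrreducibleModPGaloisRep p)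
    (hNorm : ∃ u : ℚ, (u : ℝ) = κ ∧ padicValRat p u = 0) (hκ0 : κ ≠ 0)
    (d' : ℤ) (hcd : Int.gcd (c * d) A = 1) (hdd' : d * d' ≡ 1 [ZMOD (A : ℤ)])
    (hAN : Nat.Coprime A N) (hpN : p ^ 2 ∣ N)
    (aM : ℕ → ℤ) (haM : ∀ q ∈ (p * A).primeFactors, cuspCoeff f q = aM q)
    (hE0 : ∏ q ∈ (p * A).primeFactors, (1 - (aM q : ℚ) / q + (if q ∣ N then 0 else (1 / q : ℚ))) ≠ 0)
    (hE : padicValRat p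
      (∏ q ∈ (p * A).primeFactors, (1 - (aM q : ℚ) / q + (if q ∣ N then 0 else (1 / q : ℚ)))) = 0)
    (hR0 : (c : ℚ) ^ 2 * (d : ℚ) ^ 2 * ratMinusSymbol f ((a : ℚ) / A) -
        (c : ℚ) * (d : ℚ) ^ 2 * ratMinusSymbol f ((a * c : ℚ) / A) -
        (c : ℚ) ^ 2 * (d : ℚ) * ratMinusSymbol f ((a * d' : ℚ) / A) +
        (c : ℚ) * (d : ℚ) * ratMinusSymbol f ((a * c * d' : ℚ) / A) ≠ 0)
    (hR : padicValRat p ((c : ℚ) ^ 2 * (d : ℚ) ^ 2 * ratMinusSymbol f ((a : ℚ) / A) -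
        (c : ℚ) * (d : ℚ) ^ 2 * ratMinusSymbol f ((a * c : ℚ) / A) -
        (c : ℚ) ^ 2 * (d : ℚ) * ratMinusSymbol f ((a * d' : ℚ) / A) +
        (c : ℚ) * (d : ℚ) * ratMinusSymbol f ((a * c * d' : ℚ) / A)) = 0)
    (η : (q : HeightOneSpectrum (𝓞 ℚ)) → (ZMod (Ideal.absNorm q.asIdeal))ˣ) :
    ∀ (j : ℕ) (σ : HeightOneSpectrum (𝓞 ℚ) → absoluteGaloisGroup ℚ),
      (∀ q, σ q ∈ (adicCompletionPrime ℚ q).inertia (absoluteGaloisGroup ℚ)) →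
      (∀ q, modNCyclotomicCharacter ℚ (Ideal.absNorm q.asIdeal) (σ q) = η q) →
      ∀ (r : Finset (HeightOneSpectrum (𝓞 ℚ)))
        (hr : ∀ q ∈ r, q ∈ (cyclotomicLevelsRat p (badPlaces c d A N)).primes),
        (∀ q ∈ r, Kato.IsKolyvaginPrime W p (j + 1) ((primesEquiv q : Nat.Primes) : ℕ)) →
        (∀ q ∈ r, Subgroup.zpowers (η q) = ⊤) →
        ∃ (s : ℤ_[p]) (u : (ZMod (p ^ (j + 1)))ˣ)
          (ψ : (ℓ : ℕ) → (ZMod ℓ)ˣ →* Multiplicative (ZMod (p ^ (j + 1)))),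
          (∀ q ∈ r, Function.Surjective (ψ (Ideal.absNorm q.asIdeal))) ∧
          (∃ l ∈ cycIntLattice p (cycLevel p 0 r),
            (((p : ℕ) : ℤ_[p]) ^ (0 : ℕ)) • ((1 : ℚ_[p]) ⊗ₜ[ℚ]
              ((r.noncommProd (fun ℓ : HeightOneSpectrum (𝓞 ℚ) =>
                  ∑ j ∈ Finset.range (((primesEquiv ℓ : Nat.Primes) : ℕ) - 1),
                    (j : Module.End ℚ (CyclotomicField (cycLevel p 0 r) ℚ)) *
                      (sigma (cycLevel p 0 r) (modNCyclotomicCharacter ℚ (cycLevel p 0 r) (σ ℓ)) :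
                        CyclotomicField (cycLevel p 0 r) ℚ →ₐ[ℚ]
                          CyclotomicField (cycLevel p 0 r) ℚ).toLinearMap ^ j)
                (ZetaValue.pairwise_commute_fieldDeriv (cycLevel p 0 r)
                  (fun ℓ => modNCyclotomicCharacter ℚ (cycLevel p 0 r) (σ ℓ))
                  (fun ℓ => ((primesEquiv ℓ : Nat.Primes) : ℕ) - 1) r))
                (x 0 ⟨r, hr⟩ + sigma (cycLevel p 0 r) (-1) (x 0 ⟨r, hr⟩)))) -
              ((s : ℚ_[p]) ⊗ₜ[ℚ] (1 : CyclotomicField (cycLevel p 0 r) ℚ)) =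
            (((p : ℕ) : ℤ_[p]) ^ (j + 1)) • (l : ℚ_[p] ⊗[ℚ] CyclotomicField (cycLevel p 0 r) ℚ)) ∧
          haveI : NeZero (∏ q ∈ r, Ideal.absNorm q.asIdeal) :=
            ⟨Finset.prod_ne_zero_iff.2 fun q _ h => q.ne_bot (Ideal.absNorm_eq_zero_iff.1 h)⟩
          PadicInt.toZModPow (j + 1) s = (u : ZMod (p ^ (j + 1))) *
            ((p : ℕ) : ZMod (p ^ (j + 1))) ^ (0 : ℕ) *
              kuriharaNumber f (p ^ (j + 1)) (∏ q ∈ r, Ideal.absNorm q.asIdeal) ψ :=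
  fun j σ hσI hσχ r hr hKol hη =>
    valueRow_of_zetaBody hbody hf hp2 hirr hNorm hκ0 d' hcd hdd' hAN hpN aM haM hE0 hE hR0 hR η j 0 σ
      hσI hσχ r hr hKol hη

end Main

end Summit.BirchSwinnertonDyer.Rank1Residual.GaloisImage.ValueRow

end
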